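import Summits.BirchSwinnertonDyer.BirchSwinnertonDyer.Theorems.PrintCFramBottomClassIndexLawFiveLeBernoulliUnitsEpsilonAvatar
import Summits.BirchSwinnertonDyer.BirchSwinnertonDyer.Theorems.PrintCFramBottomClassIndexLawFiveLeBernoulliUnitsLineCharacters
import HarnessLib

/-!
# Crux `PrintCFram.BottomClassIndexLawFiveLe` (stmt-BirchSwinnertonDyer-20372), line `eisenstein-resource-bdp-line` (registry v13, stub
# `stub_lineDictionary`): THE BERNOULLI UNITS OF THE KRIZ–LI DATUM, part W — THE DIRICHLET HALF OF THE LINE DICTIONARY IN ONE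
# STATEMENT (LEAD g9's request (b), STATUS 18:47Z): the odd/even lifts `r₁, r₂ ∈ {r, rε}`, their avatars `lam₁`, `lam₂` with
# `lamᵢ(χ τ) = Teich(rᵢ τ)`, `lam₁` odd with `‖B_{1,lam₁⁻¹}‖ = 1`, `r₂(c_∞) = 1`, and the Mazur–Wiles package of `ω·lam₂⁻¹`
# (cell `bsd-print-cfram`, width seat `bsd-line-cfram-p1-w3` g4; THEOREMS ONLY, `--supports` 20372; BSD is not proved by any of this)

HONEST FRAMING. Nothing here is a statement about BSD; no stub of the skeleton is closed. v13's only Stub-H residue `stub_lineDictionary`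
(`Lines/eisenstein_resource_bdp_line.lean` §1) has a Galois half (w4 g5 / LEAD g9) and a Dirichlet half; this file is the whole Dirichlet
half as ONE existential, for BOTH line characters (`r = b∘χ_m` of the SUB, `r = χ̄_p·(b∘χ_m)⁻¹` of the QUOTIENT; T1 p649783), from Stub
H's binders, T1's `(m, b, ψ₁, hψ₁)` and disjunction, the quadratic character `ε` with its pointwise avatar `hεav` (part E / D-gal) and a
complex conjugation `c_∞` with `χ_m(c_∞) = −1`, `χ̄_p(c_∞) = −1`, `ε(c_∞) = −1` (D-gal, w4 g5 file 5). Output conjuncts are spelled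
as in v13 (ii)/(iii): `(r₁ = r ∧ r₂ = rε) ∨ (r₁ = rε ∧ r₂ = r)`; `lam₁(χ_{m₁} τ) = Teich(r₁ τ)`, `lam₁.Odd`, `‖bernoulliOnePrim lam₁⁻¹‖ = 1`;
`r₂ c_∞ = 1`; `lam₂(χ_{n₂} τ) = Teich(r₂ τ)` and the `hX` package of `X = ω↑·lam₂↑⁻¹` verbatim.

* **`lineDictionary_dirichlet`** (both lines, via `hr : (r = b∘χ_m) ∨ (r = χ̄_p·(b∘χ_m)⁻¹)` pointwise).

beyond-print theorem: NO. References: [KrizLi2019] Thm. 1.20, §7.1; [MazurWiles1984] Thm. 2; [Washington1997] §5.1, Thm. 10.9; v13 §1.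
-/

set_option autoImplicit false
set_option linter.dupNamespace false

noncomputable section

open scoped Classical
open NumberField Field
open DirichletCharacter Literature.NumberTheory.LFunctions Literature.NumberTheory.EllipticCurves.KrizLi2019
  Literature.NumberTheory.EllipticCurves Literature.NumberTheory.EllipticCurves.Rank1Residual
  Literature.NumberTheory.GaloisRepresentations

namespace Summit.BirchSwinnertonDyer.BirchSwinnertonDyer.Theorems.PrintCFram.BernoulliUnits

open Summit.BirchSwinnertonDyer.BirchSwinnertonDyer.Theorems.PrintCFram

variable {p : ℕ} [hp : Fact p.Prime]

section Units

/-- `(−1)·(−1) = 1` and `(−1)·(−1)⁻¹ = 1`-type bookkeeping in `(ℤ/p)ˣ`. [folklore] -/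
theorem neg_one_mul_neg_one_units : (-1 : (ZMod p)ˣ) * (-1) = 1 := by
  rw [neg_mul_neg, one_mul]

end Units

section Dictionary

variable (W : WeierstrassCurve ℚ) [W.IsElliptic] [W.IsGloballyMinimal]

/-- **THE DIRICHLET HALF OF `stub_lineDictionary` (v13), both line characters.** Inputs: Stub H's binders; T1's line data `(m, b, ψ₁)` with
`ψ₁(u) = Teich(b u)` and the disjunction `ψ↑ = ψ₁↑ ∨ ψ↑ = ψ₁⁻¹↑·ω↑`; the character `r` of the line on `Γ_ℚ`, EITHER `r τ = b(χ_m τ)` (the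
sub-line) OR `r τ = χ̄_p(τ)·b(χ_m τ)⁻¹` (the quotient line); the quadratic character `ε` of `K''` with its pointwise avatar
`Teich(ε τ) = ε_K(χ_d τ)` (part E); and a complex conjugation `c_∞` seen through `χ_m(c_∞) = −1`, `χ̄_p(c_∞) = −1`, `ε(c_∞) = −1`.
Output: `r₁, r₂` with `{r₁, r₂} = {r, rε}` (as v13's disjunction), avatars `lam₁` (level `m₁`) and `lam₂` (level `n₂`) with
`lamᵢ(χ τ) = Teich(rᵢ τ)`, `lam₁` ODD with `‖bernoulliOnePrim lam₁⁻¹‖_p = 1`, `r₂(c_∞) = 1`, and the Mazur–Wiles package of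
`X = ω↑·lam₂↑⁻¹` (primitive ∧ odd ∧ `≠ ω` ∧ unit) — conjuncts (ii)/(iii) of v13 except the Galois ones.
[cite: KrizLi2019, Thm. 1.20 (pp. 7–8), §7.1 (p. 43)] [cite: MazurWiles1984, Thm. 2 (p. 216)] [cite: Washington1997, §5.1 and Thm. 10.9] -/
theorem lineDictionary_dirichlet (hCM : W.HasCM) (hram : CMRamified W p) (h5 : 5 ≤ p)
    (N : ℕ) (K : Type) [Field K] [NumberField K]
    {f : ℕ} [NeZero f] (ψ : DirichletCharacter ℚ_[p] f) (ω : DirichletCharacter ℚ_[p] p)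
    (εK : DirichletCharacter ℚ_[p] (NumberField.discr K).natAbs)
    (hN : W.conductorNorm ℤ = N) (hK : IsImaginaryQuadratic K) (hH : SatisfiesHeegnerHypothesis N K)
    (hω : IsTeichmullerCharacter ω)
    (hss : ∀ ℓ : ℕ, ℓ.Prime → ¬ (ℓ ∣ p * W.conductorNorm ℤ) →
      ‖((W.LFunction ℓ : ℤ) : ℚ_[p]) - (ψ (ℓ : ZMod f) + ψ⁻¹ (ℓ : ZMod f) * ω (ℓ : ZMod p))‖ < 1)
    (hεK : IsKroneckerCharacterOf K εK)
    (h4 : ¬ ‖bernoulliOnePrim (bernoulliCharOne ψ εK) * bernoulliOnePrim (bernoulliCharTwo ψ εK ω)‖ ≤ (p : ℝ)⁻¹)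
    {m : ℕ} [NeZero m] (b : (ZMod m)ˣ →* (ZMod p)ˣ) (ψ₁ : DirichletCharacter ℚ_[p] m)
    (hψ₁ : ∀ u : (ZMod m)ˣ, ψ₁ (u : ZMod m) = (((Kato2004.teichmullerChar p (b u) : ℤ_[p]ˣ) : ℤ_[p]) : ℚ_[p]))
    {M : ℕ} [NeZero M] (hf : f ∣ M) (hm : m ∣ M) (hpM : p ∣ M)
    (e : changeLevel hf ψ = changeLevel hm ψ₁ ∨ changeLevel hf ψ = changeLevel hm ψ₁⁻¹ * changeLevel hpM ω)
    (r ε : absoluteGaloisGroup ℚ →* (ZMod p)ˣ)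
    (hr : (∀ τ : absoluteGaloisGroup ℚ, r τ = b (modNCyclotomicCharacter ℚ m τ)) ∨
      (∀ τ : absoluteGaloisGroup ℚ, r τ = modNCyclotomicCharacter ℚ p τ * (b (modNCyclotomicCharacter ℚ m τ))⁻¹))
    (hεav : haveI : NeZero (NumberField.discr K).natAbs := ⟨Int.natAbs_ne_zero.mpr (NumberField.discr_ne_zero K)⟩
      ∀ τ : absoluteGaloisGroup ℚ, (((Kato2004.teichmullerChar p (ε τ) : ℤ_[p]ˣ) : ℤ_[p]) : ℚ_[p]) =
        εK ((modNCyclotomicCharacter ℚ (NumberField.discr K).natAbs τ : (ZMod (NumberField.discr K).natAbs)ˣ) :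
          ZMod (NumberField.discr K).natAbs))
    (c : absoluteGaloisGroup ℚ) (hmc : modNCyclotomicCharacter ℚ m c = -1) (hpc : modNCyclotomicCharacter ℚ p c = -1)
    (hεc : ε c = -1) :
    ∃ (r₁ r₂ : absoluteGaloisGroup ℚ →* (ZMod p)ˣ) (m₁ : ℕ) (_ : NeZero m₁) (lam₁ : DirichletCharacter ℚ_[p] m₁)
      (n₂ : ℕ) (_ : NeZero n₂) (lam₂ : DirichletCharacter ℚ_[p] n₂),
      ((r₁ = r ∧ r₂ = r * ε) ∨ (r₁ = r * ε ∧ r₂ = r)) ∧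
      (∀ τ : absoluteGaloisGroup ℚ, lam₁ ((modNCyclotomicCharacter ℚ m₁ τ : (ZMod m₁)ˣ) : ZMod m₁) =
        (((Kato2004.teichmullerChar p (r₁ τ) : ℤ_[p]ˣ) : ℤ_[p]) : ℚ_[p])) ∧
      lam₁.Odd ∧ ‖bernoulliOnePrim lam₁⁻¹‖ = 1 ∧
      r₂ c = 1 ∧
      (∀ τ : absoluteGaloisGroup ℚ, lam₂ ((modNCyclotomicCharacter ℚ n₂ τ : (ZMod n₂)ˣ) : ZMod n₂) =
        (((Kato2004.teichmullerChar p (r₂ τ) : ℤ_[p]ˣ) : ℤ_[p]) : ℚ_[p])) ∧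
      (haveI : NeZero (n₂ * p) := ⟨Nat.mul_ne_zero (NeZero.ne n₂) (Fact.out : p.Prime).ne_zero⟩
        let X : DirichletCharacter ℚ_[p] (n₂ * p) :=
          DirichletCharacter.changeLevel (dvd_mul_left p n₂) ω * (DirichletCharacter.changeLevel (dvd_mul_right n₂ p) lam₂)⁻¹
        haveI : NeZero X.conductor := ⟨X.conductor_ne_zero⟩
        X.primitiveCharacter.IsPrimitive ∧ X.primitiveCharacter.Odd ∧
          (¬ ∀ a : ℤ, ¬ ((p : ℤ) ∣ a) → ‖X.primitiveCharacter (a : ZMod X.conductor) - (a : ℚ_[p])‖ < 1) ∧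
          ‖bernoulliOnePrim X.primitiveCharacter⁻¹‖ = 1) := by
  -- common data
  haveI hdz : NeZero (NumberField.discr K).natAbs := ⟨Int.natAbs_ne_zero.mpr (NumberField.discr_ne_zero K)⟩
  have hpp := hp.out
  have hp2 : p ≠ 2 := by have := hpp.two_le; omega
  have hωodd : ω.Odd := KrizLiBinders.teichmuller_apply_neg_one hp2 hω
  have hεq : εK⁻¹ = εK := inv_eq_self_of_isKroneckerCharacterOf K hεK
  have hεodd : εK.Odd := odd_of_isKroneckerCharacterOf K hK hεK
  have hpar := odd_iff_of_teichmuller_lift hp2 b hψ₁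
  -- the big level `M' = m · |d_K| · p` and the four candidate lifts
  haveI : NeZero (m * (NumberField.discr K).natAbs * p) := ⟨Nat.mul_ne_zero (Nat.mul_ne_zero (NeZero.ne m) (NeZero.ne (NumberField.discr K).natAbs)) hpp.ne_zero⟩
  haveI : NeZero (m * (NumberField.discr K).natAbs) := ⟨Nat.mul_ne_zero (NeZero.ne m) (NeZero.ne (NumberField.discr K).natAbs)⟩
  haveI : NeZero (m * p) := ⟨Nat.mul_ne_zero (NeZero.ne m) hpp.ne_zero⟩
  have hmM : m ∣ m * (NumberField.discr K).natAbs * p := dvd_mul_of_dvd_left (dvd_mul_right m (NumberField.discr K).natAbs) p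
  have hdM : (NumberField.discr K).natAbs ∣ m * (NumberField.discr K).natAbs * p := dvd_mul_of_dvd_left (dvd_mul_left (NumberField.discr K).natAbs m) p
  have hpM' : p ∣ m * (NumberField.discr K).natAbs * p := dvd_mul_left p (m * (NumberField.discr K).natAbs)
  have hmdM : m * (NumberField.discr K).natAbs ∣ m * (NumberField.discr K).natAbs * p := dvd_mul_right (m * (NumberField.discr K).natAbs) p
  have hmdpM : m * (NumberField.discr K).natAbs * p ∣ m * (NumberField.discr K).natAbs * p := dvd_rfl
  have hmpM : m * p ∣ m * (NumberField.discr K).natAbs * p := ⟨(NumberField.discr K).natAbs, by ring⟩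
  -- lift 1: `ψ₁` itself (level `m`)
  have el₁ : changeLevel hmM ψ₁ = changeLevel hmM ψ₁ := rfl
  -- lift 2: `ψ₁↑·εK↑` (level `m·|d_K|`)
  set lam₂' : DirichletCharacter ℚ_[p] (m * (NumberField.discr K).natAbs) := changeLevel (dvd_mul_right m (NumberField.discr K).natAbs) ψ₁ * changeLevel (dvd_mul_left (NumberField.discr K).natAbs m) εK
    with hlam₂'
  have el₂ : changeLevel hmdM lam₂' = changeLevel hmM ψ₁ * changeLevel hdM εK := by
    rw [hlam₂', map_mul, ← changeLevel_trans, ← changeLevel_trans]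
  -- lift 3: `ψ₁⁻¹↑·ω↑` (level `m·p`)
  set lam₃' : DirichletCharacter ℚ_[p] (m * p) := changeLevel (dvd_mul_right m p) ψ₁⁻¹ * changeLevel (dvd_mul_left p m) ω
    with hlam₃'
  have el₃ : changeLevel hmpM lam₃' = changeLevel hmM ψ₁⁻¹ * changeLevel hpM' ω := by
    rw [hlam₃', map_mul, ← changeLevel_trans, ← changeLevel_trans]
  -- lift 4: `ψ₁⁻¹↑·ω↑·εK↑` (level `m·|d_K|·p`)
  set lam₄' : DirichletCharacter ℚ_[p] (m * (NumberField.discr K).natAbs * p) := changeLevel hmM ψ₁⁻¹ * changeLevel hpM' ω * changeLevel hdM εK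
    with hlam₄'
  have el₄ : changeLevel hmdpM lam₄' = changeLevel hmM ψ₁⁻¹ * changeLevel hpM' ω * changeLevel hdM εK := by
    rw [hlam₄', changeLevel_self]
  -- the four lifts' parities and units
  obtain ⟨c1, c2, c3, c4⟩ := odd_iff_of_lift hmM hmM hdM hpM' ψ₁ ψ₁ hεodd hωodd
  have c2' := (odd_iff_of_lift hmdM hmM hdM hpM' lam₂' ψ₁ hεodd hωodd).2.1 el₂
  have c3' := (odd_iff_of_lift hmpM hmM hdM hpM' lam₃' ψ₁ hεodd hωodd).2.2.1 el₃
  have c4' := (odd_iff_of_lift hmdpM hmM hdM hpM' lam₄' ψ₁ hεodd hωodd).2.2.2 el₄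
  have U₁ := fourLifts_of_heegner W hCM hram h5 N K ψ ω εK hN hK hH hω hss hεK h4 ψ₁ hf hm hpM e ψ₁ hmM hmM hdM hpM' hmdM
    hmdpM (Or.inl el₁)
  have U₂ := fourLifts_of_heegner W hCM hram h5 N K ψ ω εK hN hK hH hω hss hεK h4 ψ₁ hf hm hpM e lam₂' hmdM hmM hdM hpM' hmdM
    hmdpM (Or.inr (Or.inl el₂))
  have U₃ := fourLifts_of_heegner W hCM hram h5 N K ψ ω εK hN hK hH hω hss hεK h4 ψ₁ hf hm hpM e lam₃' hmpM hmM hdM hpM' hmdM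
    hmdpM (Or.inr (Or.inr (Or.inl el₃)))
  have U₄ := fourLifts_of_heegner W hCM hram h5 N K ψ ω εK hN hK hH hω hss hεK h4 ψ₁ hf hm hpM e lam₄' hmdpM hmM hdM hpM' hmdM
    hmdpM (Or.inr (Or.inr (Or.inr el₄)))
  have X₁ := mazurWilesReady_of_even_lift W hCM hram h5 N K ψ ω εK hN hK hH hω hss hεK h4 ψ₁ hf hm hpM e ψ₁ hmM hmM hdM hpM'
    hmdM hmdpM (Or.inl el₁)
  have X₂ := mazurWilesReady_of_even_lift W hCM hram h5 N K ψ ω εK hN hK hH hω hss hεK h4 ψ₁ hf hm hpM e lam₂' hmdM hmM hdM hpM'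
    hmdM hmdpM (Or.inr (Or.inl el₂))
  have X₃ := mazurWilesReady_of_even_lift W hCM hram h5 N K ψ ω εK hN hK hH hω hss hεK h4 ψ₁ hf hm hpM e lam₃' hmpM hmM hdM hpM'
    hmdM hmdpM (Or.inr (Or.inr (Or.inl el₃)))
  have X₄ := mazurWilesReady_of_even_lift W hCM hram h5 N K ψ ω εK hN hK hH hω hss hεK h4 ψ₁ hf hm hpM e lam₄' hmdpM hmM hdM hpM'
    hmdM hmdpM (Or.inr (Or.inr (Or.inr el₄)))
  -- the four avatars at their own levels
  have A₁ := fun τ => (avatar_level_of_lift_psi b hψ₁ hmM hmM ψ₁ el₁ τ).symm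
  have A₂ := fun τ => (avatar_level_of_lift_psiEps b hψ₁ ε hεav hmdM hmM hdM lam₂' el₂ τ).symm
  have A₃ := fun τ => (avatar_level_of_lift_psiInvOmega hp2 b hψ₁ hω hmpM hmM hpM' lam₃' el₃ τ).symm
  have A₄ := fun τ => (avatar_level_of_lift_psiInvOmegaEps hp2 b hψ₁ ε hεav hω hmdpM hmM hdM hpM' lam₄' el₄ τ).symm
  rcases hr with hr | hr
  · -- SUB line: `r = b ∘ χ_m`; lifts `ψ₁` (= r) and `ψ₁ε_K` (= rε)
    have hrc : r c = b (-1) := by rw [hr c, hmc]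
    rcases ψ₁.even_or_odd with hev | hodd
    · -- `ψ₁` even: `r` even, `rε` odd ⟹ r₁ = rε (lam₂'), r₂ = r (ψ₁)
      have hb1 : b (-1) = 1 := hpar.2.mp hev
      refine ⟨r * ε, r, m * (NumberField.discr K).natAbs, inferInstance, lam₂', m, inferInstance, ψ₁, Or.inr ⟨rfl, rfl⟩, fun τ => ?_, (c2').mpr hev,
        U₂.1 ((c2').mpr hev), ?_, fun τ => ?_, X₁ hev⟩
      · rw [A₂ τ, MonoidHom.mul_apply, hr τ]
      · rw [hrc, hb1]
      · rw [A₁ τ, hr τ]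
    · -- `ψ₁` odd: r₁ = r (ψ₁), r₂ = rε (lam₂')
      have hb1 : b (-1) = -1 := hpar.1.mp hodd
      have hev₂ : lam₂'.Even := by
        rcases lam₂'.even_or_odd with h | h
        · exact h
        · exact absurd ((c2').mp h) (EisensteinPair.not_even_of_odd' ψ₁ hodd)
      refine ⟨r, r * ε, m, inferInstance, ψ₁, m * (NumberField.discr K).natAbs, inferInstance, lam₂', Or.inl ⟨rfl, rfl⟩, fun τ => ?_, hodd, U₁.1 hodd, ?_,
        fun τ => ?_, X₂ hev₂⟩
      · rw [A₁ τ, hr τ]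
      · rw [MonoidHom.mul_apply, hrc, hb1, hεc, neg_one_mul_neg_one_units]
      · rw [A₂ τ, MonoidHom.mul_apply, hr τ]
  · -- QUOTIENT line: `r = χ̄_p · (b ∘ χ_m)⁻¹`; lifts `ψ₁⁻¹ω` (= r) and `ψ₁⁻¹ωε_K` (= rε)
    have hrc : r c = -1 * (b (-1))⁻¹ := by rw [hr c, hpc, hmc]
    rcases ψ₁.even_or_odd with hev | hodd
    · -- `ψ₁` even: `ψ₁⁻¹ω` odd ⟹ r₁ = r (lam₃'), r₂ = rε (lam₄')
      have hb1 : b (-1) = 1 := hpar.2.mp hev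
      have hev₄ : lam₄'.Even := by
        rcases lam₄'.even_or_odd with h | h
        · exact h
        · exact absurd hev (EisensteinPair.not_even_of_odd' ψ₁ ((c4').mp h))
      refine ⟨r, r * ε, m * p, inferInstance, lam₃', m * (NumberField.discr K).natAbs * p, inferInstance, lam₄', Or.inl ⟨rfl, rfl⟩, fun τ => ?_, (c3').mpr hev,
        U₃.1 ((c3').mpr hev), ?_, fun τ => ?_, X₄ hev₄⟩
      · rw [A₃ τ, hr τ]
      · rw [MonoidHom.mul_apply, hrc, hb1, hεc, inv_one, mul_one, neg_one_mul_neg_one_units]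
      · rw [A₄ τ, MonoidHom.mul_apply, hr τ]
    · -- `ψ₁` odd: `ψ₁⁻¹ωε_K` odd ⟹ r₁ = rε (lam₄'), r₂ = r (lam₃')
      have hb1 : b (-1) = -1 := hpar.1.mp hodd
      have hev₃ : lam₃'.Even := by
        rcases lam₃'.even_or_odd with h | h
        · exact h
        · exact absurd ((c3').mp h) (EisensteinPair.not_even_of_odd' ψ₁ hodd)
      refine ⟨r * ε, r, m * (NumberField.discr K).natAbs * p, inferInstance, lam₄', m * p, inferInstance, lam₃', Or.inr ⟨rfl, rfl⟩, fun τ => ?_, (c4').mpr hodd,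
        U₄.1 ((c4').mpr hodd), ?_, fun τ => ?_, X₃ hev₃⟩
      · rw [A₄ τ, MonoidHom.mul_apply, hr τ]
      · rw [hrc, hb1, inv_neg_one, neg_one_mul_neg_one_units]
      · rw [A₃ τ, hr τ]

end Dictionary

end Summit.BirchSwinnertonDyer.BirchSwinnertonDyer.Theorems.PrintCFram.BernoulliUnits

end
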